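import Literature.AlgebraicGeometry.ShimuraVarieties.UnitaryBallCauchyRiemannDictionary
import Literature.Computability.AlgebraicComplexity.LinSubst
import Mathlib.LinearAlgebra.Vandermonde
import HarnessLib

/-!
# The Cauchy–Riemann dictionary on `U(2,1)` for every `K`-type: the factors `j₁`, `j₂` and `Symʲ`

Topic `AlgebraicGeometry/ShimuraVarieties`; namespace `Literature.AlgebraicGeometry.ShimuraVarieties.BallForms` (the
grouping namespace of the tree's ball-model automorphic forms). Sequel of `UnitaryBallCauchyRiemannDictionary`:
that file proves, for ANY holomorphic automorphy factor (`IsHolScalarFactor` / `IsHolMatrixFactor`: cocycle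
identities, holomorphy in `z`, first-order holomorphy along `exp 𝔭` at the base point),
`F holomorphic on 𝔹² ⟺ 𝔭₋ · f_F = 0 ⟺ f_F is 𝔭-holomorphic` (both directions), and verifies the hypothesis for
the two weights of record (cotangent `Jacᵀ`, canonical `(det Jac)ᵏ`). Its module doc lists as NOT THERE "the
verification that the automorphy factor of a general `K`-type `τ` of `U(2) × U(1)` … satisfies
`IsHolMatrixFactor` (an explicit computation with the fractional-linear formulas of `UnitBallJacobian`)". This file
is that computation, for every weight `(j, k)` and character `detˡ` of the vector-valued Picard modular forms of
Cléry–van der Geer. Everything here is a definition with a body or a kernel-checked theorem; no named fact, no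
`Prop`-valued record (net debt 0).

## Content

* §1 **calculus of holomorphic factors**: `IsHolScalarFactor.mul / inv / pow / zpow`; `IsHolMatrixFactor.det`
  (the determinant of a holomorphic matrix factor is a holomorphic scalar factor), `IsHolMatrixFactor.smul`
  (scalar twists `j • M`), `IsHolMatrixFactor.map` (composition with a multiplicative, unital, `ℂ`-differentiable
  `ρ : M_n(ℂ) → M_{n'}(ℂ)` — a polynomial representation of the matrix monoid).
* §2 **the factors of automorphy of `U(2,1)` on `𝔹²`** in the notation of [CleryVanDerGeer2013, §1]:
  `jOne g z = j₁(g; z) = g₂₀ z₀ + g₂₁ z₁ + g₂₂` (the denominator of the action — the tree's third homogeneous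
  coordinate `W3 g z 2`), `jTwoInv g z = j₂(g; z)⁻¹ := j₁(g; z) · (Jac g z)ᵀ` (their eq. (3)) and
  `jTwo = (jTwoInv)⁻¹`; the identities `det Jac = det g / j₁³` (their (1) — the tree's `det_Jac`),
  `det j₂⁻¹ = det g / j₁`, `det j₂ = j₁ / det g`, the cocycle identities in both orders (`jOne_mul`,
  `jTwoInv_mul` pull-back order, `jTwo_mul` holomorphic order), the entries `j₂⁻¹ = (A - (g·z) C)ᵀ` for
  `g = [[A, B], [C, d]]` (`jTwoInv_apply`), and on the isotropy group `K = Stab(x₀) = U(2) × U(1)`: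
  `j₁(k₀; x₀) = d`, `j₂(k₀; x₀)⁻¹ = Aᵀ` (`jOne_x₀_eq`, `jTwoInv_x₀_of_smul_eq`). THEOREMS: `isHolScalarFactor_jOne`
  (the one analytic input beyond the dictionary file: `b ↦ j₁(exp X_b; x₀) = (exp X_b)₂₂` has ZERO derivative at
  `b = 0` because `(X_b)₂₂ = 0` — first-order triviality of the `U(1)`-part of the isotropy factor along `exp 𝔭`),
  `isHolMatrixFactor_jTwoInv` (`= j₁ • Jacᵀ`, a scalar twist of the cotangent factor), `isHolScalarFactor_det`
  (`det g = j₁ · det j₂⁻¹`, so `b ↦ det exp X_b` needs no `det ∘ exp = exp ∘ tr`).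
* §3 **`Symʲ` as a polynomial matrix functor**: `symPow j A ∈ M_{j+1}(ℂ)`, the matrix in the monomial basis
  `X₀ˡ X₁ʲ⁻ˡ` (`symMonomial j l`, `0 ≤ l ≤ j`) of the tree's linear substitution `linSubst A`
  (`X_i ↦ Σ_m A_{mi} X_m`, i.e. `p ↦ p ∘ Aᵀ`; file `Computability/AlgebraicComplexity/LinSubst`) on binary forms of
  degree `j`; `symPow_one`, `symPow_mul` (from `linSubst_one / linSubst_mul` and the monomial expansion
  `eq_sum_coeff_smul_symMonomial` of a form of degree `j`), `symPow_zero` (`Sym⁰ = 1`), and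
  `differentiable_symPow` (the entries of `Symʲ(A)` are polynomials in the entries of `A`: the coefficients of a
  form of degree `j` are inverse-Vandermonde combinations of its values at the `j + 1` points `(t, 1)`,
  `t = 0, …, j`, and `(A · X₀ⁱX₁ʲ⁻ⁱ)(v) = (Σ_m A_{m0} v_m)ⁱ (Σ_m A_{m1} v_m)ʲ⁻ⁱ`).
* §4 **the weights**: `picardFactor j k ℓ g z = det(g)^{-ℓ} j₁(g; z)^{-k} • Symʲ(j₂(g; z)⁻¹)` (`j ∈ ℕ`,
  `k, ℓ ∈ ℤ`): the factor of the slash operator `slash j k g F z = (F |_{j,k} g)(z) = j₁^{-k} Symʲ(j₂⁻¹) F(g z)`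
  twisted by the character `det^{-ℓ}`, in the tree's pull-back convention; `mem_factorForms_picardCocycle_iff`:
  `F ∈ factorForms Γ (picardCocycle j k ℓ) ⟺ F |_{j,k} γ = det(γ)ˡ F (γ ∈ Γ)`, so that
  `holFactorForms Γ (picardCocycle j k ℓ)` is literally the displayed definition of the space `M_{j,k}(Γ, detˡ)` of
  vector-valued Picard modular forms of the source (which imposes no condition at the cusps); `slash_zero_apply`
  (weight `(0, k)` = scalar weight `k`: `F(γ z) = j₁(γ; z)ᵏ F(z)`); the group function of the cocycle is the
  classical lift `g ↦ det(g)^{-ℓ} (F |_{j,k} g)(x₀)` (`toGroupFun_picardCocycle_apply`).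
  MAIN THEOREM `isHolMatrixFactor_picardFactor` (§1 applied to §2–§3), whence the dictionary for every weight with
  no hypothesis left: `mem_holomorphic_iff_isPHolomorphic_weight`, `mem_holomorphic_iff_isKilledByPMinus_weight`
  (`F : 𝔹² → Symʲ(ℂ²) = ℂʲ⁺¹` is holomorphic iff its group function is killed by `𝔭₋`, iff it is `𝔭`-holomorphic)
  and the weight-form versions `mem_holWeightForms_iff_isPHolomorphic_weight` /
  `mem_holWeightForms_iff_isKilledByPMinus_weight`.

WHICH `K`-TYPES. The isotropy representation `weightOf x₀ : k₀ ↦ picardFactor j k ℓ k₀⁻¹ x₀` of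
`picardCocycle j k ℓ` on `K = U(2) × U(1) ∋ k₀ = diag(A, d)` is `(d · det A)ˡ · dᵏ · Symʲ(A⁻ᵀ)` (by `jOne_x₀_eq`,
`jTwoInv_x₀_of_smul_eq`), i.e. the `K`-type `Symʲ(std)^∨ ⊗ detˡ ⊠ χ^{k+ℓ} ≅ Symʲ ⊗ det^{ℓ-j} ⊠ χ^{k+ℓ}`
(`χ` the identity character of `U(1)`); as `(j, k, ℓ)` ranges over `ℕ × ℤ × ℤ` the triples `(j, ℓ - j, k + ℓ)`
range over `ℕ × ℤ × ℤ`, which by the (classical, not formalised here) classification of the irreducible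
representations of `U(2) × U(1)` is every irreducible `K`-type. Reducible `K`-types (direct sums, tensor products)
are covered by §1 applied again; they are not spelled out.

ORIENTATION / CONVENTIONS (unchanged from the tree). Pull-back convention throughout: `M(gh, z) = M(h, z) M(g, hz)`,
`toGroupFun (matrixCocycle M) x₀ F g = M(g, x₀) F(g x₀)`, `F ∈ factorForms Γ ⟺ F z = M(γ, z) F(γ z)`; so the
`GL₂`-valued object entering the weights is `j₂⁻¹` (`jTwoInv`, cocycle identity in the pull-back order), and
`j₂` (`jTwo`) satisfies the holomorphic-order identity `j₂(gh; z) = j₂(g; hz) j₂(h; z)`. The source writes the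
Hermitian form in Finis' normalisation (denominator row = second row); the tree's form is `diag(1, 1, -1)` with
affine chart `z ↦ (z₀ : z₁ : 1)`, where the denominator row is the third — `j₁` (denominator of the action),
`J = Jac` (Jacobian of the action) and the relation (3) `j₂⁻¹ = j₁ Jᵗ` are statements about the action and are
taken in that sense. `Symʲ` is realised by the matrices of `linSubst` on binary forms of degree `j` in the basis
`X₀ˡX₁ʲ⁻ˡ` — a polynomial representation of `M₂(ℂ)` with `diag(a, d) ↦ diag(aˡ dʲ⁻ˡ)_l`, highest weight `j`; any
other matrix realisation of `Symʲ` differs by a constant conjugation, which `IsHolMatrixFactor.map` covers as well.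
`𝔭₋` is the lower-left block, as pinned in `UnitaryBallPSplit` / the dictionary file.

NOT HERE: Fourier–Jacobi expansions, cusps, Hecke operators and the generators/relations that are the theorems of
[CleryVanDerGeer2013]; the `(𝔤, K)`-module reading of the dictionary (Borel–Wallach); smoothness of any particular
`f` (theta lifts); the classification of the irreducible representations of `U(2) × U(1)`.

## References (locators read on the held copies; private calculus helpers are `[folklore]`)

* F. Cléry, G. van der Geer, *Generators for modules of vector-valued Picard modular forms*, Nagoya Math. J. 212
  (2013) 19–57 [CleryVanDerGeer2013], §1 "The Picard Modular Group" [corpus:paper:arxiv-1202.0131 p0003]: the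
  denominator `j₁(g,u,v) := g₃₁u + g₃₂v + g₃₃` defines a factor of automorphy for the action; the Jacobian `J(g,u,v)`
  of the action defines a second factor of automorphy, with `det J(g,u,v) = j₁(g,u,v)⁻³ det(g)` (1); the factor
  `j₂` with `det j₂(g,u,v) = j₁(g,u,v)/det(g)` and `j₂(g,u,v)⁻¹ = j₁(g,u,v) J(g,u,v)ᵗ` (3); the slash operator
  `(f|_{j,k} g)(u,v) = j₁(g,u,v)⁻ᵏ Symʲ(j₂(g,u,v)⁻¹) f(g·(u,v))` on `f : B → Symʲ(ℂ²)`; and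
  `M_{j,k}(Γ, χ) = {f : B → Symʲ(ℂ²) holomorphic, f|_{j,k} g = χ(g) f for all g ∈ Γ}`, `χ` a power of `det`.
* A. Borel, *Automorphic forms on SL₂(ℝ)* (1997) [Borel1997]: 3.3 (6)–(7) (automorphy factors, the cocycle
  identity, products and powers of factors) and §5.13–5.14 (the lift `f ↦ f̃(g) = f(g·0) μ(g, 0)⁻ᵐ`, weight forms).
* S. Kudla, *From modular forms to automorphic representations* (2004) [Kudla2004], Lemma 1.3 (a form is
  holomorphic iff its lift is killed by `X₋` — the `SL₂` prototype of the dictionary).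
* D. Bump, *Automorphic Forms and Representations* (1997) [Bump1997], §3.2 (2.13) (the lowering operator and the
  Cauchy–Riemann equations).

## Provenance

Written for the COR-CM cell `pub-hodgecm2` (Hodge ladder stage 2), literature fan-out row D9 (b) "`𝔭₋ · F = 0 ⟺`
holomorphy of the associated vector-valued function" (MODEL-N N-h2 (ii) of the stage-1 cell), closing gap G1 of that
cell's audit of row D9. Kernel only; nothing here is a claim of the manuscripts adjudicated by those cells.
-/

set_option autoImplicit false

noncomputable section

open scoped Matrix Matrix.Norms.Operator Topology ComplexConjugate
open MulAction
open Literature.Geometry.ComplexHyperbolic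
open Literature.Geometry.ComplexHyperbolic.BallModel
open Literature.NumberTheory.Automorphic Literature.NumberTheory.Automorphic.AutomorphyFactor

namespace Literature.AlgebraicGeometry.ShimuraVarieties

namespace BallForms

/-! ### 0. Calculus helpers (entries ⟷ matrices, determinants, the ambient criterion for holomorphy) -/

section Calculus

variable {n : Type} [Fintype n] [DecidableEq n]
variable {E : Type*} [NormedAddCommGroup E] [NormedSpace ℂ E]

/-- A matrix-valued function with `ℂ`-differentiable entries is `ℂ`-differentiable (any norm on matrices;
`C = Σ Cᵢⱼ Eᵢⱼ`). [folklore] -/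
private theorem differentiableAt_matrix_of_entries {C : E → Matrix n n ℂ} {x : E}
    (h : ∀ i j : n, DifferentiableAt ℂ (fun y => C y i j) x) : DifferentiableAt ℂ C x := by
  have hfun : C = fun y => ∑ i, ∑ j, C y i j • Matrix.single i j (1 : ℂ) := by
    funext y
    exact (Matrix.matrix_eq_sum_single (C y)).trans
      (Finset.sum_congr rfl fun i _ => Finset.sum_congr rfl fun j _ => by
        rw [Matrix.smul_single, smul_eq_mul, mul_one])
  rw [hfun]
  exact DifferentiableAt.fun_sum fun i _ => DifferentiableAt.fun_sum fun j _ => (h i j).smul_const _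

/-- Entries of a `ℂ`-differentiable matrix-valued function are `ℂ`-differentiable. [folklore] -/
private theorem differentiableAt_apply_entry {C : E → Matrix n n ℂ} {x : E} (h : DifferentiableAt ℂ C x)
    (i j : n) : DifferentiableAt ℂ (fun y => C y i j) x :=
  (entryL i j).differentiableAt.comp x h

/-- A finite product of `ℂ`-differentiable scalar functions is `ℂ`-differentiable. [folklore] -/
private theorem differentiableAt_finset_prod {ι : Type*} {u : Finset ι} {f : ι → E → ℂ} {x : E}
    (h : ∀ i ∈ u, DifferentiableAt ℂ (f i) x) : DifferentiableAt ℂ (fun y => ∏ i ∈ u, f i y) x := by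
  classical
  exact (HasFDerivAt.finsetProd fun i hi => (h i hi).hasFDerivAt).differentiableAt

/-- The determinant of a matrix-valued function with `ℂ`-differentiable entries is `ℂ`-differentiable
(Leibniz expansion). [folklore] -/
private theorem differentiableAt_det_of_entries {C : E → Matrix n n ℂ} {x : E}
    (h : ∀ i j : n, DifferentiableAt ℂ (fun y => C y i j) x) :
    DifferentiableAt ℂ (fun y => (C y).det) x := by
  simp only [Matrix.det_apply']
  exact DifferentiableAt.fun_sum fun σ _ =>
    (differentiableAt_finset_prod fun i _ => h (σ i) i).const_mul _

variable {W : Type*} [NormedAddCommGroup W] [NormedSpace ℂ W]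

/-- **Ambient criterion.** A function on the ball that is the restriction of an ambient function
`ℂ`-differentiable at the points of the ball is holomorphic (the ball is open). [folklore] -/
private theorem mem_holomorphic_of_ambient' (φ : Ball → W) (Φ : (Fin 2 → ℂ) → W)
    (h : ∀ z : Ball, φ z = Φ z.1) (hΦ : ∀ y ∈ ballSet, DifferentiableAt ℂ Φ y) : φ ∈ holomorphic W := by
  rw [mem_holomorphic_iff]
  intro y hy
  have hev : extend W φ =ᶠ[𝓝 y] Φ := by
    filter_upwards [isOpen_ballSet.mem_nhds hy] with w hw
    rw [← h ⟨w, hw⟩, ← extend_apply_coe φ ⟨w, hw⟩]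
  exact ((hev.differentiableAt_iff).2 (hΦ y hy)).differentiableWithinAt

/-- The zero extension of a holomorphic function is `ℂ`-differentiable at the points of the ball. [folklore] -/
private theorem differentiableAt_extend_of_mem {φ : Ball → W} (hφ : φ ∈ holomorphic W) {y : Fin 2 → ℂ}
    (hy : y ∈ ballSet) : DifferentiableAt ℂ (extend W φ) y :=
  differentiableAt_extend hφ ⟨y, hy⟩

end Calculus

/-! ### 1. Calculus of holomorphic automorphy factors -/

section FactorCalculus

namespace IsHolScalarFactor

variable {j j' : U21 → Ball → ℂ}

/-- **Products of holomorphic scalar factors are holomorphic scalar factors** (`j j'`: e.g. `j₁ᵃ (det g)ᵇ`).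
[cite: Borel1997, 3.3 (6)–(7)] -/
theorem mul (hj : IsHolScalarFactor j) (hj' : IsHolScalarFactor j') :
    IsHolScalarFactor (fun g z => j g z * j' g z) where
  map_one z := by rw [hj.map_one, hj'.map_one, mul_one]
  map_mul g h z := by rw [hj.map_mul, hj'.map_mul]; ring
  mem_holomorphic g :=
    mem_holomorphic_of_ambient' _ (fun y => extend ℂ (j g) y * extend ℂ (j' g) y)
      (fun z => by rw [extend_apply_coe, extend_apply_coe])
      fun _ hy => (differentiableAt_extend_of_mem (hj.mem_holomorphic g) hy).mul
        (differentiableAt_extend_of_mem (hj'.mem_holomorphic g) hy)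
  differentiableAt_expP := hj.differentiableAt_expP.mul hj'.differentiableAt_expP

/-- **The inverse of a holomorphic scalar factor is a holomorphic scalar factor** (it does not vanish,
`IsHolScalarFactor.ne_zero`). [cite: Borel1997, 3.3 (6)–(7)] -/
theorem inv (hj : IsHolScalarFactor j) : IsHolScalarFactor (fun g z => (j g z)⁻¹) where
  map_one z := by rw [hj.map_one, inv_one]
  map_mul g h z := by rw [hj.map_mul, mul_inv]
  mem_holomorphic g :=
    mem_holomorphic_of_ambient' _ (fun y => (extend ℂ (j g) y)⁻¹)
      (fun z => by rw [extend_apply_coe])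
      fun y hy => (differentiableAt_extend_of_mem (hj.mem_holomorphic g) hy).inv (by
        rw [show y = (⟨y, hy⟩ : Ball).1 from rfl, extend_apply_coe]
        exact hj.ne_zero g ⟨y, hy⟩)
  differentiableAt_expP := hj.differentiableAt_expP.inv (hj.ne_zero _ _)

/-- **Natural powers of a holomorphic scalar factor are holomorphic scalar factors.** [cite: Borel1997, 3.3 (6)–(7)] -/
theorem pow (hj : IsHolScalarFactor j) (m : ℕ) : IsHolScalarFactor (fun g z => j g z ^ m) where
  map_one z := by rw [hj.map_one, one_pow]
  map_mul g h z := by rw [hj.map_mul, mul_pow]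
  mem_holomorphic g :=
    mem_holomorphic_of_ambient' _ (fun y => extend ℂ (j g) y ^ m)
      (fun z => by rw [extend_apply_coe])
      fun _ hy => (differentiableAt_extend_of_mem (hj.mem_holomorphic g) hy).pow m
  differentiableAt_expP := hj.differentiableAt_expP.pow m

/-- **Integer powers of a holomorphic scalar factor are holomorphic scalar factors** (negative weights).
[cite: Borel1997, 3.3 (6)–(7)] -/
theorem zpow (hj : IsHolScalarFactor j) (m : ℤ) : IsHolScalarFactor (fun g z => j g z ^ m) := by
  obtain ⟨k, rfl | rfl⟩ := Int.eq_nat_or_neg m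
  · simpa only [zpow_natCast] using hj.pow k
  · simpa only [zpow_neg, zpow_natCast] using (hj.pow k).inv

end IsHolScalarFactor

namespace IsHolMatrixFactor

variable {n : Type} [Fintype n] [DecidableEq n]
variable {M : U21 → Ball → Matrix n n ℂ}

omit [Fintype n] [DecidableEq n] in
/-- The ambient matrix function `y ↦ (extend (M g · i i') y)ᵢᵢ'` restricts to `M g` on the ball. [folklore] -/
private theorem ambient_eq (g : U21) (z : Ball) :
    (Matrix.of fun i i' => extend ℂ (fun w : Ball => M g w i i') z.1) = M g z := by
  ext i i'
  rw [Matrix.of_apply, extend_apply_coe]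

/-- … and is `ℂ`-differentiable at the points of the ball. [folklore] -/
private theorem differentiableAt_ambient (hM : IsHolMatrixFactor M) (g : U21) {y : Fin 2 → ℂ}
    (hy : y ∈ ballSet) :
    DifferentiableAt ℂ (fun y => Matrix.of fun i i' => extend ℂ (fun w : Ball => M g w i i') y) y :=
  differentiableAt_matrix_of_entries fun i i' => by
    simpa only [Matrix.of_apply] using differentiableAt_extend_of_mem (hM.mem_holomorphic g i i') hy

/-- **The determinant of a holomorphic matrix factor is a holomorphic scalar factor** (e.g. `det Jacᵀ = det Jac`,
the canonical factor; `det j₂⁻¹ = det g / j₁`). [cite: Borel1997, 3.3 (6)–(7)] -/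
theorem det (hM : IsHolMatrixFactor M) : IsHolScalarFactor (fun g z => (M g z).det) where
  map_one z := by rw [hM.map_one, Matrix.det_one]
  map_mul g h z := by rw [hM.map_mul, Matrix.det_mul]
  mem_holomorphic g :=
    mem_holomorphic_of_ambient' _
      (fun y => (Matrix.of fun i i' => extend ℂ (fun w : Ball => M g w i i') y).det)
      (fun z => by rw [ambient_eq])
      fun _ hy => differentiableAt_det_of_entries fun i i' => by
        simpa only [Matrix.of_apply] using differentiableAt_extend_of_mem (hM.mem_holomorphic g i i') hy
  differentiableAt_expP := differentiableAt_det_of_entries hM.differentiableAt_expP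

/-- **Scalar twists**: for a holomorphic scalar factor `j` and a holomorphic matrix factor `M`, `j • M` is a
holomorphic matrix factor (the factors `j₁ᵃ (det g)ᵇ ⊗ τ`). [cite: Borel1997, 3.3 (6)–(7)] -/
theorem smul (hM : IsHolMatrixFactor M) {j : U21 → Ball → ℂ} (hj : IsHolScalarFactor j) :
    IsHolMatrixFactor (fun g z => j g z • M g z) where
  map_one z := by rw [hj.map_one, hM.map_one, one_smul]
  map_mul g h z := by
    rw [hj.map_mul, hM.map_mul, Matrix.smul_mul, Matrix.mul_smul, smul_smul, mul_comm]
  mem_holomorphic g i i' :=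
    mem_holomorphic_of_ambient' _ (fun y => extend ℂ (j g) y * extend ℂ (fun w : Ball => M g w i i') y)
      (fun z => by rw [Matrix.smul_apply, smul_eq_mul, extend_apply_coe, extend_apply_coe])
      fun _ hy => (differentiableAt_extend_of_mem (hj.mem_holomorphic g) hy).mul
        (differentiableAt_extend_of_mem (hM.mem_holomorphic g i i') hy)
  differentiableAt_expP i i' := by
    simp only [Matrix.smul_apply, smul_eq_mul]
    exact hj.differentiableAt_expP.mul (hM.differentiableAt_expP i i')

/-- **Functoriality**: for a holomorphic matrix factor `M` with values in `M_n(ℂ)` and a multiplicative,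
unital, `ℂ`-differentiable map `ρ : M_n(ℂ) → M_{n'}(ℂ)` (a polynomial representation of the matrix monoid,
e.g. `Symʲ`), `ρ ∘ M` is a holomorphic matrix factor. [cite: Borel1997, 3.3 (6)–(7)] -/
theorem map {n' : Type} [Fintype n'] [DecidableEq n'] (hM : IsHolMatrixFactor M)
    (ρ : Matrix n n ℂ → Matrix n' n' ℂ) (h1 : ρ 1 = 1) (hmul : ∀ A B, ρ (A * B) = ρ A * ρ B)
    (hρ : Differentiable ℂ ρ) : IsHolMatrixFactor (fun g z => ρ (M g z)) where
  map_one z := by rw [hM.map_one, h1]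
  map_mul g h z := by rw [hM.map_mul, hmul]
  mem_holomorphic g l l' :=
    mem_holomorphic_of_ambient' _
      (fun y => ρ (Matrix.of fun i i' => extend ℂ (fun w : Ball => M g w i i') y) l l')
      (fun z => by rw [ambient_eq])
      fun y hy => differentiableAt_apply_entry ((hρ _).comp y (hM.differentiableAt_ambient g hy)) l l'
  differentiableAt_expP l l' :=
    differentiableAt_apply_entry
      ((hρ _).comp (0 : Fin 2 → ℂ) (differentiableAt_matrix_of_entries hM.differentiableAt_expP)) l l'

end IsHolMatrixFactor

end FactorCalculus

/-! ### 2. The factors of automorphy `j₁`, `j₂` of `U(2,1)` on `𝔹²` (Cléry–van der Geer) -/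

section PicardFactors

/-- **The factor of automorphy `j₁(g; z) = g₂₀ z₀ + g₂₁ z₁ + g₂₂`**: the denominator of the fractional-linear
action `z ↦ ((g(z,1))₀, (g(z,1))₁) / (g(z,1))₂` of `U(2,1)` on the ball, i.e. the third homogeneous coordinate
`(g · (z, 1))₂ = W3 g z 2` (the tree's Hermitian form is `diag(1,1,-1)` and the chart is `z ↦ (z₀ : z₁ : 1)`, so
the denominator row is the third). [cite: CleryVanDerGeer2013, §1 (j₁(g,u,v) := g₃₁u + g₃₂v + g₃₃)] -/
def jOne (g : U21) (z : Ball) : ℂ := W3 g z 2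

/-- `j₁(g; z) = g₂₀ z₀ + g₂₁ z₁ + g₂₂`. [cite: CleryVanDerGeer2013, §1 (definition of j₁)] -/
theorem jOne_apply (g : U21) (z : Ball) : jOne g z = mat g 2 0 * z.1 0 + mat g 2 1 * z.1 1 + mat g 2 2 :=
  W3_apply g z 2

/-- `j₁(g; z) ≠ 0` on the ball. [cite: CleryVanDerGeer2013, §1 (definition of j₁)] -/
theorem jOne_ne_zero (g : U21) (z : Ball) : jOne g z ≠ 0 := W3_2_ne_zero g z

/-- `j₁(1; z) = 1`. [cite: CleryVanDerGeer2013, §1 (j₁ is a factor of automorphy)] -/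
@[simp] theorem jOne_one (z : Ball) : jOne 1 z = 1 := by
  rw [jOne, W3_one, lift_2]

/-- **`j₁` is a factor of automorphy**: `j₁(gh; z) = j₁(h; z) j₁(g; h z)`. [cite: CleryVanDerGeer2013, §1 (j₁ is a factor of automorphy)] -/
theorem jOne_mul (g h : U21) (z : Ball) : jOne (g * h) z = jOne h z * jOne g (h • z) := by
  simp only [jOne]
  rw [W3_smul, ← W3_mul, ← mul_assoc, mul_inv_cancel₀ (W3_2_ne_zero h z), one_mul]

/-- At the base point, `j₁(g; x₀) = g₂₂`. [cite: CleryVanDerGeer2013, §1 (definition of j₁)] -/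
theorem jOne_x₀ (g : U21) : jOne g x₀ = mat g 2 2 := by
  rw [jOne_apply, x₀_val, Pi.zero_apply, Pi.zero_apply, mul_zero, mul_zero, zero_add, zero_add]

/-- The Jacobian determinant in terms of `j₁`: `det J(g; z) = j₁(g; z)⁻³ det g`.
[cite: CleryVanDerGeer2013, §1 eq. (1)] -/
theorem canonicalFactor_eq_det_div (g : U21) (z : Ball) :
    canonicalFactor g z = (mat g).det / jOne g z ^ 3 :=
  det_Jac g z

/-- **The factor `j₂(g; z)⁻¹ := j₁(g; z) · J(g; z)ᵀ`** (`J = Jac` the Jacobian of the action): the `GL₂`-part of the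
canonical automorphy factor in the pull-back convention of the tree (`j₂⁻¹(gh; z) = j₂⁻¹(h; z) j₂⁻¹(g; hz)`); its
entries are `(A - (g·z) C)ᵀ` for `g = [[A, *], [C, *]]`. [cite: CleryVanDerGeer2013, §1 eq. (3)] -/
def jTwoInv (g : U21) (z : Ball) : Matrix (Fin 2) (Fin 2) ℂ := jOne g z • (Jac g z)ᵀ

/-- Unfolding `jTwoInv`. [cite: CleryVanDerGeer2013, §1 eq. (3)] -/
theorem jTwoInv_def (g : U21) (z : Ball) : jTwoInv g z = jOne g z • (Jac g z)ᵀ := rfl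

/-- The entries of `j₂(g; z)⁻¹`: `(j₂⁻¹)ᵢₖ = gₖᵢ - (g·z)ₖ g₂ᵢ`, i.e. `j₂⁻¹ = (A - (g·z) C)ᵀ`.
[cite: CleryVanDerGeer2013, §1 eq. (3)] -/
theorem jTwoInv_apply (g : U21) (z : Ball) (i k : Fin 2) :
    jTwoInv g z i k = mat g (Fin.castSucc k) (Fin.castSucc i) - (g • z).1 k * mat g 2 (Fin.castSucc i) := by
  have h2 : W3 g z 2 ≠ 0 := W3_2_ne_zero g z
  rw [jTwoInv, Matrix.smul_apply, Matrix.transpose_apply, smul_eq_mul, jOne, smul_val, Jac, Matrix.of_apply]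
  field_simp

/-- `j₂(1; z)⁻¹ = 1`. [cite: CleryVanDerGeer2013, §1 eq. (3)] -/
@[simp] theorem jTwoInv_one (z : Ball) : jTwoInv 1 z = 1 := by
  rw [jTwoInv, jOne_one, one_smul, transpose_Jac_one]

/-- **`j₂⁻¹` is a factor of automorphy (pull-back order)**: `j₂⁻¹(gh; z) = j₂⁻¹(h; z) · j₂⁻¹(g; h z)`.
[cite: CleryVanDerGeer2013, §1 eq. (3)] -/
theorem jTwoInv_mul (g h : U21) (z : Ball) : jTwoInv (g * h) z = jTwoInv h z * jTwoInv g (h • z) := by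
  rw [jTwoInv, jTwoInv, jTwoInv, jOne_mul, transpose_Jac_mul, Matrix.smul_mul, Matrix.mul_smul, smul_smul]

/-- `det j₂(g; z)⁻¹ = det g / j₁(g; z)`. [cite: CleryVanDerGeer2013, §1 (det j₂ = j₁ / det g)] -/
theorem det_jTwoInv (g : U21) (z : Ball) : (jTwoInv g z).det = (mat g).det / jOne g z := by
  have h2 : jOne g z ≠ 0 := jOne_ne_zero g z
  rw [jTwoInv, Matrix.det_smul, Matrix.det_transpose, Fintype.card_fin, det_Jac, ← jOne]
  field_simp

/-- `j₁(g; z) · det j₂(g; z)⁻¹ = det g`. [cite: CleryVanDerGeer2013, §1 (det j₂ = j₁ / det g)] -/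
theorem jOne_mul_det_jTwoInv (g : U21) (z : Ball) : jOne g z * (jTwoInv g z).det = (mat g).det := by
  rw [det_jTwoInv, mul_div_cancel₀ _ (jOne_ne_zero g z)]

/-- **The factor of automorphy `j₂(g; z) := (j₁(g; z) J(g; z)ᵀ)⁻¹ ∈ GL₂(ℂ)`** (holomorphic order:
`j₂(gh; z) = j₂(g; hz) j₂(h; z)`). [cite: CleryVanDerGeer2013, §1 eq. (3)] -/
def jTwo (g : U21) (z : Ball) : Matrix (Fin 2) (Fin 2) ℂ := (jTwoInv g z)⁻¹

/-- Unfolding `jTwo`. [cite: CleryVanDerGeer2013, §1 eq. (3)] -/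
theorem jTwo_def (g : U21) (z : Ball) : jTwo g z = (jTwoInv g z)⁻¹ := rfl

/-- `det j₂(g; z)⁻¹ ≠ 0`. [cite: CleryVanDerGeer2013, §1 (det j₂ = j₁ / det g)] -/
theorem det_jTwoInv_ne_zero (g : U21) (z : Ball) : (jTwoInv g z).det ≠ 0 := by
  rw [det_jTwoInv]
  exact div_ne_zero (det_mat_ne_zero g) (jOne_ne_zero g z)

/-- `j₂ · j₂⁻¹ = 1`. [cite: CleryVanDerGeer2013, §1 eq. (3)] -/
theorem jTwo_mul_jTwoInv (g : U21) (z : Ball) : jTwo g z * jTwoInv g z = 1 :=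
  Matrix.nonsing_inv_mul _ (isUnit_iff_ne_zero.2 (det_jTwoInv_ne_zero g z))

/-- `(j₂)⁻¹ = j₂⁻¹` (the matrix inverse of `jTwo` is `jTwoInv`). [cite: CleryVanDerGeer2013, §1 eq. (3)] -/
theorem jTwo_inv (g : U21) (z : Ball) : (jTwo g z)⁻¹ = jTwoInv g z :=
  Matrix.nonsing_inv_nonsing_inv _ (isUnit_iff_ne_zero.2 (det_jTwoInv_ne_zero g z))

/-- `det j₂(g; z) = j₁(g; z) / det g`. [cite: CleryVanDerGeer2013, §1 (det j₂ = j₁ / det g)] -/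
theorem det_jTwo (g : U21) (z : Ball) : (jTwo g z).det = jOne g z / (mat g).det := by
  rw [jTwo, Matrix.det_nonsing_inv, det_jTwoInv, Ring.inverse_eq_inv', inv_div]

/-- **`j₂` is a factor of automorphy (holomorphic order)**: `j₂(gh; z) = j₂(g; hz) · j₂(h; z)`.
[cite: CleryVanDerGeer2013, §1 eq. (3)] -/
theorem jTwo_mul (g h : U21) (z : Ball) : jTwo (g * h) z = jTwo g (h • z) * jTwo h z := by
  rw [jTwo, jTwo, jTwo, jTwoInv_mul, Matrix.mul_inv_rev]

/-! #### `j₁`, `j₂⁻¹` and `det g` are holomorphic factors -/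

/-- At the base point `(g · (x₀, 1))₂ = g₂₂`; along `exp 𝔭`: `j₁(exp X_b; x₀) = (exp X_b)₂₂`. [folklore] -/
private theorem jOne_expP_x₀ (b : Fin 2 → ℂ) : jOne (expP b) x₀ = (NormedSpace.exp (pMat b)) 2 2 := by
  rw [jOne_x₀, mat_expP]

/-- **First-order triviality of `j₁` along `exp 𝔭`**: `b ↦ j₁(exp X_b; x₀) = (exp X_b)₂₂ = 1 + |b|²/2 + …` has ZERO
real derivative at `b = 0` (`(X_b)₂₂ = 0`). [folklore] -/
private theorem hasFDerivAt_jOne_expP :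
    HasFDerivAt (fun b : Fin 2 → ℂ => jOne (expP b) x₀) (0 : (Fin 2 → ℂ) →L[ℝ] ℂ) 0 := by
  have hfun : (fun b : Fin 2 → ℂ => jOne (expP b) x₀) =
      fun b => (entryL (m := Fin 3) (n := Fin 3) 2 2) (NormedSpace.exp (pMat b)) := by
    funext b
    rw [jOne_expP_x₀, entryL_apply]
  rw [hfun]
  have h := (((entryL (m := Fin 3) (n := Fin 3) 2 2).restrictScalars ℝ).hasFDerivAt).comp
    (0 : Fin 2 → ℂ) hasFDerivAt_exp_pMat
  refine h.congr_fderiv ?_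
  ext b
  change (entryL (m := Fin 3) (n := Fin 3) 2 2) (pMatL b) = 0
  rw [pMatL_apply, entryL_apply, pMat_apply_22]

/-- … hence `b ↦ j₁(exp X_b; x₀)` is `ℂ`-differentiable at `b = 0` (with derivative `0`). [folklore] -/
private theorem differentiableAt_jOne_expP :
    DifferentiableAt ℂ (fun b : Fin 2 → ℂ => jOne (expP b) x₀) 0 :=
  (hasFDerivAt_of_restrictScalars ℝ (f' := (0 : (Fin 2 → ℂ) →L[ℂ] ℂ)) hasFDerivAt_jOne_expP
    (by simp)).differentiableAt

/-- **`j₁` is a holomorphic scalar factor**: cocycle, affine (hence holomorphic) in `z`, and first-order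
trivial along `exp 𝔭` at the base point. [cite: CleryVanDerGeer2013, §1 (j₁ is a factor of automorphy)] -/
theorem isHolScalarFactor_jOne : IsHolScalarFactor jOne where
  map_one := jOne_one
  map_mul := jOne_mul
  mem_holomorphic g :=
    mem_holomorphic_of_ambient' _ (fun y => homogAmb g y 2) (fun _ => rfl)
      fun y _ => differentiableAt_homogAmb g 2 y
  differentiableAt_expP := differentiableAt_jOne_expP

/-- **`j₂⁻¹ = j₁ · Jacᵀ` is a holomorphic matrix factor** (scalar twist of the cotangent factor `Jacᵀ` of the
dictionary file by `j₁`). [cite: CleryVanDerGeer2013, §1 eq. (3)] -/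
theorem isHolMatrixFactor_jTwoInv : IsHolMatrixFactor jTwoInv :=
  isHolMatrixFactor_transpose_Jac.smul isHolScalarFactor_jOne

/-- **The character `det : U(2,1) → U(1)` is a holomorphic scalar factor** (constant in `z`): indeed
`det g = j₁(g; z) · det j₂(g; z)⁻¹`, a product of holomorphic factors — in particular `b ↦ det (exp X_b)` is
`ℂ`-differentiable at `0` with no appeal to `det exp = exp tr`. [cite: CleryVanDerGeer2013, §1 (characters detˡ)] -/
theorem isHolScalarFactor_det : IsHolScalarFactor (fun (g : U21) (_ : Ball) => (mat g).det) := by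
  have h : (fun (g : U21) (z : Ball) => jOne g z * (jTwoInv g z).det) = fun (g : U21) (_ : Ball) => (mat g).det :=
    funext fun g => funext fun z => jOne_mul_det_jTwoInv g z
  rw [← h]
  exact isHolScalarFactor_jOne.mul isHolMatrixFactor_jTwoInv.det

end PicardFactors

/-! ### 3. The symmetric powers `Symʲ` as a polynomial matrix functor on `M₂(ℂ)` -/

section SymPow

open MvPolynomial
open Literature.Computability.AlgebraicComplexity

variable (j : ℕ)

/-- The exponent vector of the monomial `X₀ˡ X₁ʲ⁻ˡ` (`l ≤ j`, so `j - l` is an honest difference).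
[cite: CleryVanDerGeer2013, §1 (Symʲ(ℂ²))] -/
def symExp (l : Fin (j + 1)) : Fin 2 →₀ ℕ :=
  Finsupp.single 0 (l : ℕ) + Finsupp.single 1 (j - (l : ℕ))

/-- `(symExp j l)₀ = l`. [cite: CleryVanDerGeer2013, §1 (Symʲ(ℂ²))] -/
@[simp] theorem symExp_apply_zero (l : Fin (j + 1)) : symExp j l 0 = l := by
  simp [symExp]

/-- `(symExp j l)₁ = j - l`. [cite: CleryVanDerGeer2013, §1 (Symʲ(ℂ²))] -/
@[simp] theorem symExp_apply_one (l : Fin (j + 1)) : symExp j l 1 = j - (l : ℕ) := by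
  simp [symExp]

/-- `X₀ˡ X₁ʲ⁻ˡ` has degree `j`. [cite: CleryVanDerGeer2013, §1 (Symʲ(ℂ²))] -/
theorem degree_symExp (l : Fin (j + 1)) : (symExp j l).degree = j := by
  rw [symExp, map_add, Finsupp.degree_single, Finsupp.degree_single]
  exact Nat.add_sub_cancel' (Nat.lt_succ_iff.mp l.2)

/-- `l ↦ X₀ˡ X₁ʲ⁻ˡ` is injective. [cite: CleryVanDerGeer2013, §1 (Symʲ(ℂ²))] -/
theorem symExp_injective : Function.Injective (symExp j) := by
  intro l l' h
  have h0 := congrArg (fun d : Fin 2 →₀ ℕ => d 0) h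
  simp only [symExp_apply_zero] at h0
  exact Fin.ext h0

/-- Every exponent vector of degree `j` in two variables is an `X₀ˡ X₁ʲ⁻ˡ`. [cite: CleryVanDerGeer2013, §1 (Symʲ(ℂ²))] -/
theorem exists_eq_symExp_of_degree {d : Fin 2 →₀ ℕ} (hd : d.degree = j) : ∃ l : Fin (j + 1), d = symExp j l := by
  rw [Finsupp.degree_eq_sum, Fin.sum_univ_two] at hd
  refine ⟨⟨d 0, by omega⟩, Finsupp.ext fun i => ?_⟩
  fin_cases i
  · show d 0 = symExp j _ 0
    rw [symExp_apply_zero]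
  · show d 1 = symExp j _ 1
    rw [symExp_apply_one]
    dsimp only
    omega

/-- **The monomial basis `X₀ˡ X₁ʲ⁻ˡ` (`0 ≤ l ≤ j`) of `Symʲ(ℂ²)`**, realised as the degree-`j` forms in two
variables. [cite: CleryVanDerGeer2013, §1 (Symʲ(ℂ²))] -/
def symMonomial (l : Fin (j + 1)) : MvPolynomial (Fin 2) ℂ := monomial (symExp j l) 1

/-- `symMonomial j l = X₀ˡ X₁ʲ⁻ˡ`. [cite: CleryVanDerGeer2013, §1 (Symʲ(ℂ²))] -/
theorem symMonomial_eq (l : Fin (j + 1)) :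
    symMonomial j l = X 0 ^ (l : ℕ) * X 1 ^ (j - (l : ℕ)) := by
  rw [symMonomial, symExp, X_pow_eq_monomial, X_pow_eq_monomial, monomial_mul, mul_one]

/-- `X₀ˡ X₁ʲ⁻ˡ` is homogeneous of degree `j`. [cite: CleryVanDerGeer2013, §1 (Symʲ(ℂ²))] -/
theorem isHomogeneous_symMonomial (l : Fin (j + 1)) : (symMonomial j l).IsHomogeneous j :=
  isHomogeneous_monomial _ (degree_symExp j l)

/-- Coefficients of the basis monomials: `⟨X₀ˡX₁ʲ⁻ˡ, X₀ⁱX₁ʲ⁻ⁱ⟩ = δ_{il}`. [cite: CleryVanDerGeer2013, §1 (Symʲ(ℂ²))] -/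
theorem coeff_symExp_symMonomial (l i : Fin (j + 1)) :
    coeff (symExp j l) (symMonomial j i) = if i = l then 1 else 0 := by
  classical
  rw [symMonomial, coeff_monomial]
  by_cases h : i = l
  · rw [if_pos (congrArg (symExp j) h), if_pos h]
  · rw [if_neg (fun h' => h (symExp_injective j h')), if_neg h]

/-- **Monomial expansion**: a form of degree `j` in two variables is the combination of the `X₀ˡ X₁ʲ⁻ˡ` with
its coefficients. [cite: CleryVanDerGeer2013, §1 (Symʲ(ℂ²))] -/
theorem eq_sum_coeff_smul_symMonomial {p : MvPolynomial (Fin 2) ℂ} (hp : p.IsHomogeneous j) :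
    p = ∑ l : Fin (j + 1), coeff (symExp j l) p • symMonomial j l := by
  classical
  refine MvPolynomial.ext _ _ fun d => ?_
  simp only [coeff_sum, coeff_smul, symMonomial, coeff_monomial, smul_eq_mul, mul_ite, mul_one, mul_zero]
  by_cases hd : d.degree = j
  · obtain ⟨l, rfl⟩ := exists_eq_symExp_of_degree j hd
    rw [Finset.sum_eq_single l]
    · rw [if_pos rfl]
    · intro l' _ hl'
      rw [if_neg (fun h => hl' (symExp_injective j h))]
    · intro h
      exact absurd (Finset.mem_univ l) h
  · rw [hp.coeff_eq_zero hd]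
    refine (Finset.sum_eq_zero fun l _ => ?_).symm
    rw [if_neg]
    intro h
    apply hd
    rw [← h]
    exact degree_symExp j l

/-- **`Symʲ(A)`** for `A ∈ M₂(ℂ)`: the matrix, in the monomial basis `X₀ˡ X₁ʲ⁻ˡ`, of the linear substitution
`X_i ↦ Σ_m A_{mi} X_m` (the tree's `linSubst`, `p ↦ p ∘ Aᵀ`) on forms of degree `j` — a polynomial
representation `M₂(ℂ) → M_{j+1}(ℂ)` of highest weight `j` (`diag(a, d) ↦ diag(aˡ dʲ⁻ˡ)`), i.e. a matrix realisation
of the `j`-th symmetric power of the standard representation of `GL₂(ℂ)`. [cite: CleryVanDerGeer2013, §1 (slash operator |_{j,k}, Symʲ)] -/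
def symPow (A : Matrix (Fin 2) (Fin 2) ℂ) : Matrix (Fin (j + 1)) (Fin (j + 1)) ℂ :=
  Matrix.of fun l i => coeff (symExp j l) (linSubst (Fin 2) ℂ A (symMonomial j i))

/-- Entries of `Symʲ(A)`. [cite: CleryVanDerGeer2013, §1 (Symʲ)] -/
theorem symPow_apply (A : Matrix (Fin 2) (Fin 2) ℂ) (l i : Fin (j + 1)) :
    symPow j A l i = coeff (symExp j l) (linSubst (Fin 2) ℂ A (symMonomial j i)) := rfl

/-- **Defining property**: `A · X₀ⁱX₁ʲ⁻ⁱ = Σ_l Symʲ(A)_{li} X₀ˡX₁ʲ⁻ˡ` (columns of `Symʲ(A)` = coordinates of the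
substituted basis monomials). [cite: CleryVanDerGeer2013, §1 (Symʲ)] -/
theorem linSubst_symMonomial (A : Matrix (Fin 2) (Fin 2) ℂ) (i : Fin (j + 1)) :
    linSubst (Fin 2) ℂ A (symMonomial j i) = ∑ l, symPow j A l i • symMonomial j l :=
  eq_sum_coeff_smul_symMonomial j (linSubst_isHomogeneous A (isHomogeneous_symMonomial j i))

/-- `Symʲ(1) = 1`. [cite: CleryVanDerGeer2013, §1 (Symʲ)] -/
theorem symPow_one : symPow j (1 : Matrix (Fin 2) (Fin 2) ℂ) = 1 := by
  ext l i
  rw [symPow_apply, linSubst_one, AlgHom.id_apply, coeff_symExp_symMonomial, Matrix.one_apply]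
  exact if_congr eq_comm rfl rfl

/-- `Sym⁰(A) = 1` (`1 × 1`): weight `(0, k)` is scalar weight `k`. [cite: CleryVanDerGeer2013, §1 (weight (0,k) = scalar weight k)] -/
theorem symPow_zero (A : Matrix (Fin 2) (Fin 2) ℂ) : symPow 0 A = 1 := by
  ext l i
  obtain rfl : l = 0 := Fin.eq_zero l
  obtain rfl : i = 0 := Fin.eq_zero i
  have h0 : symExp 0 0 = 0 := by
    ext m
    fin_cases m <;> simp [symExp]
  rw [symPow_apply, Matrix.one_apply_eq, symMonomial, h0, ← C_apply, C_1, map_one, coeff_zero_one]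

/-- **`Symʲ` is multiplicative**: `Symʲ(AB) = Symʲ(A) Symʲ(B)` (functoriality of substitution). [cite: CleryVanDerGeer2013, §1 (Symʲ)] -/
theorem symPow_mul (A B : Matrix (Fin 2) (Fin 2) ℂ) : symPow j (A * B) = symPow j A * symPow j B := by
  ext l i
  rw [Matrix.mul_apply, symPow_apply, linSubst_mul, AlgHom.comp_apply, linSubst_symMonomial j B i, map_sum,
    coeff_sum]
  refine Finset.sum_congr rfl fun l' _ => ?_
  simp only [map_smul, coeff_smul, smul_eq_mul, symPow_apply]
  ring

/-- Evaluation of a substituted basis monomial: `(A · X₀ⁱX₁ʲ⁻ⁱ)(v) = (Σ_m A_{m0} v_m)ⁱ (Σ_m A_{m1} v_m)ʲ⁻ⁱ`.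
[cite: CleryVanDerGeer2013, §1 (Symʲ)] -/
theorem eval_linSubst_symMonomial (A : Matrix (Fin 2) (Fin 2) ℂ) (v : Fin 2 → ℂ) (i : Fin (j + 1)) :
    eval v (linSubst (Fin 2) ℂ A (symMonomial j i)) =
      (∑ m, A m 0 * v m) ^ (i : ℕ) * (∑ m, A m 1 * v m) ^ (j - (i : ℕ)) := by
  have hX : ∀ k : Fin 2, eval v (linSubst (Fin 2) ℂ A (X k)) = ∑ m, A m k * v m := by
    intro k
    rw [linSubst_X, map_sum]
    exact Finset.sum_congr rfl fun m _ => by rw [smul_eval, eval_X]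
  rw [symMonomial_eq, map_mul, map_pow, map_pow, map_mul, map_pow, map_pow, hX, hX]

/-! #### Coefficients from values (Vandermonde), and differentiability of `A ↦ Symʲ(A)` -/

/-- The interpolation nodes `0, 1, …, j ∈ ℂ`. [folklore] -/
private def node (t : Fin (j + 1)) : ℂ := ((t : ℕ) : ℂ)

/-- The nodes are distinct. [folklore] -/
private theorem node_injective : Function.Injective (node j) := fun _ _ h =>
  Fin.ext (Nat.cast_injective (R := ℂ) h)

/-- The Vandermonde matrix `(tˡ)` of the nodes. [folklore] -/
private def vdm : Matrix (Fin (j + 1)) (Fin (j + 1)) ℂ := Matrix.vandermonde (node j)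

/-- It is invertible. [folklore] -/
private theorem isUnit_det_vdm : IsUnit (vdm j).det :=
  isUnit_iff_ne_zero.2 (Matrix.det_vandermonde_ne_zero_iff.2 (node_injective j))

/-- Values at `(t, 1)` of a form of degree `j` = Vandermonde matrix × coefficient vector. [folklore] -/
private theorem eval_eq_vdm_mulVec {p : MvPolynomial (Fin 2) ℂ} (hp : p.IsHomogeneous j) (t : Fin (j + 1)) :
    eval ![node j t, 1] p = (vdm j *ᵥ fun l => coeff (symExp j l) p) t := by
  conv_lhs => rw [eq_sum_coeff_smul_symMonomial j hp]
  rw [map_sum]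
  simp only [Matrix.mulVec, dotProduct, vdm, Matrix.vandermonde_apply]
  refine Finset.sum_congr rfl fun l _ => ?_
  rw [smul_eval, symMonomial_eq, map_mul, map_pow, map_pow, eval_X, eval_X]
  simp [mul_comm]

/-- **Coefficients from values**: the coefficients of a form of degree `j` are fixed linear combinations
(inverse Vandermonde) of its values at the `j + 1` points `(t, 1)`. [folklore] -/
private theorem coeff_eq_vdm_inv_mulVec {p : MvPolynomial (Fin 2) ℂ} (hp : p.IsHomogeneous j) :
    (fun l => coeff (symExp j l) p) = (vdm j)⁻¹ *ᵥ fun t => eval ![node j t, 1] p := by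
  have hev : (vdm j *ᵥ fun l => coeff (symExp j l) p) = fun t => eval ![node j t, 1] p := by
    funext t
    exact (eval_eq_vdm_mulVec j hp t).symm
  rw [← hev, Matrix.mulVec_mulVec, Matrix.nonsing_inv_mul _ (isUnit_det_vdm j), Matrix.one_mulVec]

/-- … entrywise: `coeff_l p = Σ_t (V⁻¹)_{lt} p(t, 1)`. [folklore] -/
private theorem coeff_symExp_eq_sum_eval {p : MvPolynomial (Fin 2) ℂ} (hp : p.IsHomogeneous j)
    (l : Fin (j + 1)) : coeff (symExp j l) p = ∑ t, (vdm j)⁻¹ l t * eval ![node j t, 1] p := by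
  -- `(V⁻¹ *ᵥ f) l = Σ_t (V⁻¹)_{lt} f t` definitionally
  exact congrFun (coeff_eq_vdm_inv_mulVec j hp) l

/-- The entries of `Symʲ(A)` as explicit polynomials in the entries of `A`. [folklore] -/
private theorem symPow_apply_eq_sum (A : Matrix (Fin 2) (Fin 2) ℂ) (l i : Fin (j + 1)) :
    symPow j A l i = ∑ t, (vdm j)⁻¹ l t *
      ((∑ m, A m 0 * ![node j t, 1] m) ^ (i : ℕ) * (∑ m, A m 1 * ![node j t, 1] m) ^ (j - (i : ℕ))) := by
  rw [symPow_apply, coeff_symExp_eq_sum_eval j (linSubst_isHomogeneous A (isHomogeneous_symMonomial j i)) l]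
  exact Finset.sum_congr rfl fun t _ => by rw [eval_linSubst_symMonomial]

/-- **The entries of `Symʲ(A)` are polynomial, hence `ℂ`-differentiable, functions of `A ∈ M₂(ℂ)`.**
[cite: CleryVanDerGeer2013, §1 (Symʲ)] -/
theorem differentiable_symPow_apply (l i : Fin (j + 1)) :
    Differentiable ℂ (fun A : Matrix (Fin 2) (Fin 2) ℂ => symPow j A l i) := by
  have hfun : (fun A : Matrix (Fin 2) (Fin 2) ℂ => symPow j A l i) = fun A => ∑ t, (vdm j)⁻¹ l t *
      ((∑ m, A m 0 * ![node j t, 1] m) ^ (i : ℕ) * (∑ m, A m 1 * ![node j t, 1] m) ^ (j - (i : ℕ))) :=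
    funext fun A => symPow_apply_eq_sum j A l i
  rw [hfun]
  have he : ∀ m k : Fin 2, Differentiable ℂ (fun A : Matrix (Fin 2) (Fin 2) ℂ => A m k) := fun m k =>
    (entryL (m := Fin 2) (n := Fin 2) m k).differentiable
  have hs : ∀ (k : Fin 2) (t : Fin (j + 1)),
      Differentiable ℂ (fun A : Matrix (Fin 2) (Fin 2) ℂ => ∑ m, A m k * ![node j t, 1] m) :=
    fun k t => Differentiable.fun_sum fun m _ => (he m k).mul_const _
  exact Differentiable.fun_sum fun t _ => (((hs 0 t).pow _).mul ((hs 1 t).pow _)).const_mul _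

/-- **`A ↦ Symʲ(A)` is `ℂ`-differentiable** as a map `M₂(ℂ) → M_{j+1}(ℂ)`. [cite: CleryVanDerGeer2013, §1 (Symʲ)] -/
theorem differentiable_symPow : Differentiable ℂ (symPow j) := fun A =>
  differentiableAt_matrix_of_entries fun l i => differentiable_symPow_apply j l i A

end SymPow

/-! ### 4. The automorphy factors of the `K`-types and the dictionary for every weight `(j, k)` -/

section Weights

variable (j : ℕ) (k ℓ : ℤ)

/-- **The automorphy factor of weight `(j, k)` and character `detˡ`** (pull-back convention):
`(g, z) ↦ det(g)^{-ℓ} j₁(g; z)^{-k} Symʲ(j₂(g; z)⁻¹) ∈ GL_{j+1}(ℂ)` — the factor of the slash operator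
`(f |_{j,k} g)(z) = j₁(g; z)^{-k} Symʲ(j₂(g; z)⁻¹) f(g z)` twisted by the character `det(g)^{-ℓ}`, so that
`F ∈ factorForms Γ` iff `F |_{j,k} γ = det(γ)ˡ F` (`mem_factorForms_picardCocycle_iff`). At `g = k₀ ∈ K = U(2) × U(1)`,
`k₀ = diag(A, d)`: `j₁ = d`, `j₂⁻¹ = Aᵀ`, so the isotropy representation is `Symʲ ⊗ det^{-ℓ} ⊠ (·)^{-k-ℓ}` — every
irreducible `K`-type as `(j, k, ℓ)` ranges over `ℕ × ℤ × ℤ`. [cite: CleryVanDerGeer2013, §1 (slash operator |_{j,k}, M_{j,k}(Γ, detˡ))] -/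
def picardFactor (g : U21) (z : Ball) : Matrix (Fin (j + 1)) (Fin (j + 1)) ℂ :=
  ((mat g).det ^ (-ℓ) * jOne g z ^ (-k)) • symPow j (jTwoInv g z)

/-- Unfolding `picardFactor`. [cite: CleryVanDerGeer2013, §1 (slash operator |_{j,k})] -/
theorem picardFactor_def (g : U21) (z : Ball) :
    picardFactor j k ℓ g z = ((mat g).det ^ (-ℓ) * jOne g z ^ (-k)) • symPow j (jTwoInv g z) := rfl

/-- **The weight-`(j,k)` factors are holomorphic matrix factors** — the computation this file exists for:
cocycle identities from those of `j₁`, `j₂⁻¹`, `det`; holomorphy in `z` and first-order triviality along `exp 𝔭`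
from those of `j₁` and `Jacᵀ` through the polynomial functor `Symʲ`. [cite: CleryVanDerGeer2013, §1 (slash operator |_{j,k})] -/
theorem isHolMatrixFactor_picardFactor : IsHolMatrixFactor (picardFactor j k ℓ) :=
  (isHolMatrixFactor_jTwoInv.map (symPow j) (symPow_one j) (symPow_mul j) (differentiable_symPow j)).smul
    ((isHolScalarFactor_det.zpow (-ℓ)).mul (isHolScalarFactor_jOne.zpow (-k)))

/-- The weight-`(j,k)`, character-`detˡ` cocycle on `Symʲ(ℂ²) = ℂ^{j+1}`. [cite: CleryVanDerGeer2013, §1 (M_{j,k}(Γ, detˡ))] -/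
def picardCocycle : U21 → Ball → Module.End ℂ (Fin (j + 1) → ℂ) :=
  matrixCocycle (picardFactor j k ℓ)

/-- `picardCocycle j k ℓ g z v = picardFactor j k ℓ g z · v`. [cite: CleryVanDerGeer2013, §1 (M_{j,k}(Γ, detˡ))] -/
@[simp] theorem picardCocycle_apply (g : U21) (z : Ball) (v : Fin (j + 1) → ℂ) :
    picardCocycle j k ℓ g z v = picardFactor j k ℓ g z *ᵥ v :=
  matrixCocycle_apply _ g z v

/-- The weight-`(j,k)` cocycle is a pull-back cocycle. [cite: CleryVanDerGeer2013, §1 (M_{j,k}(Γ, detˡ))] -/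
theorem isPullbackCocycle_picardCocycle : IsPullbackCocycle (picardCocycle j k ℓ) :=
  (isHolMatrixFactor_picardFactor j k ℓ).isPullbackCocycle

/-- **The slash operator of weight `(j, k)`**: `(F |_{j,k} g)(z) = j₁(g; z)^{-k} Symʲ(j₂(g; z)⁻¹) F(g z)`.
[cite: CleryVanDerGeer2013, §1 (slash operator |_{j,k})] -/
def slash (g : U21) (F : Ball → (Fin (j + 1) → ℂ)) : Ball → (Fin (j + 1) → ℂ) :=
  fun z => jOne g z ^ (-k) • (symPow j (jTwoInv g z) *ᵥ F (g • z))

/-- Unfolding `slash`. [cite: CleryVanDerGeer2013, §1 (slash operator |_{j,k})] -/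
theorem slash_apply (g : U21) (F : Ball → (Fin (j + 1) → ℂ)) (z : Ball) :
    slash j k g F z = jOne g z ^ (-k) • (symPow j (jTwoInv g z) *ᵥ F (g • z)) := rfl

/-- Weight `(0, k)`: the slash operator of scalar weight `k`, `(F |_{0,k} g)(z) = j₁(g; z)^{-k} F(g z)` — so
`F |_{0,k} γ = F` is the classical transformation law `F(γ z) = j₁(γ; z)ᵏ F(z)` of Picard modular forms of weight `k`.
[cite: CleryVanDerGeer2013, §1 (weight (0,k) = scalar weight k)] -/
theorem slash_zero_apply (g : U21) (F : Ball → (Fin 1 → ℂ)) (z : Ball) :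
    slash 0 k g F z = jOne g z ^ (-k) • F (g • z) := by
  rw [slash_apply, symPow_zero, Matrix.one_mulVec]

/-- `picardFactor · v = det(g)^{-ℓ} • (j₁^{-k} • Symʲ(j₂⁻¹) v)`. [cite: CleryVanDerGeer2013, §1 (slash operator |_{j,k})] -/
theorem picardFactor_mulVec (g : U21) (z : Ball) (v : Fin (j + 1) → ℂ) :
    picardFactor j k ℓ g z *ᵥ v = (mat g).det ^ (-ℓ) • (jOne g z ^ (-k) • (symPow j (jTwoInv g z) *ᵥ v)) := by
  rw [picardFactor, Matrix.smul_mulVec, mul_smul]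

/-- The group function of the weight-`(j,k)` cocycle is the classical lift `g ↦ det(g)^{-ℓ} (F |_{j,k} g)(x₀)`.
[cite: Borel1997, §5.13–5.14] -/
theorem toGroupFun_picardCocycle_apply (F : Ball → (Fin (j + 1) → ℂ)) (g : U21) :
    toGroupFun (picardCocycle j k ℓ) x₀ F g = (mat g).det ^ (-ℓ) • slash j k g F x₀ := by
  rw [toGroupFun_apply, picardCocycle_apply, picardFactor_mulVec, slash_apply]

/-- **Modular forms of weight `(j, k)` and character `detˡ`**: `F ∈ factorForms Γ (picardCocycle j k ℓ)` iff
`F |_{j,k} γ = det(γ)ˡ F` for all `γ ∈ Γ` — so `holFactorForms Γ (picardCocycle j k ℓ)` is the space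
`M_{j,k}(Γ, detˡ)` of the source (holomorphy at the cusps being automatic / not at issue here).
[cite: CleryVanDerGeer2013, §1 (definition of M_{j,k}(Γ, χ))] -/
theorem mem_factorForms_picardCocycle_iff {Γ : Subgroup U21} {F : Ball → (Fin (j + 1) → ℂ)} :
    F ∈ factorForms Γ (picardCocycle j k ℓ) ↔ ∀ γ ∈ Γ, slash j k γ F = (mat γ).det ^ ℓ • F := by
  rw [mem_factorForms_iff]
  refine forall₂_congr fun γ _ => ⟨fun h => funext fun z => ?_, fun h z => ?_⟩
  · rw [Pi.smul_apply, h z, picardCocycle_apply, picardFactor_mulVec, ← slash_apply, smul_smul,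
      ← zpow_add₀ (det_mat_ne_zero γ), add_neg_cancel, zpow_zero, one_smul]
  · rw [picardCocycle_apply, picardFactor_mulVec, ← slash_apply, h, Pi.smul_apply, smul_smul,
      ← zpow_add₀ (det_mat_ne_zero γ), neg_add_cancel, zpow_zero, one_smul]

/-! #### The Cauchy–Riemann dictionary for every weight `(j, k)` and character `detˡ` -/

/-- **Cauchy–Riemann dictionary, weight `(j, k)`, both directions.** A function `F : 𝔹² → Symʲ(ℂ²) = ℂʲ⁺¹`
is holomorphic iff its group function `g ↦ det(g)^{-ℓ} j₁(g; x₀)^{-k} Symʲ(j₂(g; x₀)⁻¹) F(g x₀)` on `U(2,1)` is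
`𝔭`-holomorphic (every chart `b ↦ f(g exp X_b)` `ℂ`-differentiable at `0`). [cite: Kudla2004, Lemma 1.3] -/
theorem mem_holomorphic_iff_isPHolomorphic_weight (F : Ball → (Fin (j + 1) → ℂ)) :
    F ∈ holomorphic (Fin (j + 1) → ℂ) ↔ IsPHolomorphic (toGroupFun (picardCocycle j k ℓ) x₀ F) :=
  (isHolMatrixFactor_picardFactor j k ℓ).mem_holomorphic_iff_isPHolomorphic F

/-- **Cauchy–Riemann dictionary, weight `(j, k)`, `𝔭₋` form**: `F` is holomorphic iff its group function is
killed by `𝔭₋` (`(X_b + i X_{ib}) f = 0` at every `g`, charts real-differentiable). [cite: Bump1997, §3.2 (2.13)] -/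
theorem mem_holomorphic_iff_isKilledByPMinus_weight (F : Ball → (Fin (j + 1) → ℂ)) :
    F ∈ holomorphic (Fin (j + 1) → ℂ) ↔ IsKilledByPMinus (toGroupFun (picardCocycle j k ℓ) x₀ F) :=
  (isHolMatrixFactor_picardFactor j k ℓ).mem_holomorphic_iff_isKilledByPMinus F

/-- **Holomorphic weight forms of `K`-type `(j, k, ℓ)` on `U(2,1)` are exactly the `𝔭`-holomorphic ones.**
[cite: Borel1997, §5.13–5.14] -/
theorem mem_holWeightForms_iff_isPHolomorphic_weight {Δ : Subgroup U21}
    (f : Literature.NumberTheory.Automorphic.weightForms Δ (stabilizer U21 x₀).subtype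
      ((isPullbackCocycle_picardCocycle j k ℓ).weightOf x₀)) :
    f ∈ holWeightForms Δ (isPullbackCocycle_picardCocycle j k ℓ) ↔
      IsPHolomorphic (f : U21 → (Fin (j + 1) → ℂ)) :=
  (isHolMatrixFactor_picardFactor j k ℓ).mem_holWeightForms_iff f

/-- … and the `𝔭₋` form: `f ∈ holWeightForms Δ ⟺ 𝔭₋ · f = 0`. [cite: Borel1997, §5.13–5.14] -/
theorem mem_holWeightForms_iff_isKilledByPMinus_weight {Δ : Subgroup U21}
    (f : Literature.NumberTheory.Automorphic.weightForms Δ (stabilizer U21 x₀).subtype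
      ((isPullbackCocycle_picardCocycle j k ℓ).weightOf x₀)) :
    f ∈ holWeightForms Δ (isPullbackCocycle_picardCocycle j k ℓ) ↔
      IsKilledByPMinus (f : U21 → (Fin (j + 1) → ℂ)) := by
  rw [isKilledByPMinus_iff_isPHolomorphic, mem_holWeightForms_iff_isPHolomorphic_weight]

/-! #### The isotropy representation: which `K`-type -/

/-- On the isotropy group `K = Stab(x₀) = U(2) × U(1)` (block-diagonal `diag(A, d)`), `j₁(k₀; x₀) = d = (k₀)₂₂`.
[cite: CleryVanDerGeer2013, §1 (definition of j₁)] -/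
theorem jOne_x₀_eq (g : U21) : jOne g x₀ = mat g 2 2 := jOne_x₀ g

/-- On the isotropy group, `j₂(k₀; x₀)⁻¹ = Aᵀ` (the transposed upper-left block): `(j₂⁻¹)ᵢₗ = (k₀)ₗᵢ` when
`k₀ x₀ = x₀`. [cite: CleryVanDerGeer2013, §1 eq. (3)] -/
theorem jTwoInv_x₀_of_smul_eq {g : U21} (hg : g • x₀ = x₀) (i l : Fin 2) :
    jTwoInv g x₀ i l = mat g (Fin.castSucc l) (Fin.castSucc i) := by
  rw [jTwoInv_apply, hg, x₀_val, Pi.zero_apply, zero_mul, sub_zero]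

end Weights

end BallForms

end Literature.AlgebraicGeometry.ShimuraVarieties

end
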